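import Literature.MathematicalPhysics.QuantumFieldTheory.Balaban1983to89.T4AveragingDisintegration
import Literature.MathematicalPhysics.QuantumFieldTheory.Balaban1983to89.B12RTGaugeInvariance254
import Literature.MathematicalPhysics.QuantumFieldTheory.Balaban1983to89.T4ShellMeasureDet

/-!
# N21 (NE7c) · infrastructure: EQUIVARIANCE OF THE AVERAGING KERNEL — the fibre laws `condLaw(V, dU)` of product Haar
# measure along an averaging `Ū` are TRANSPORTS OF ONE ANOTHER along every measure-preserving intertwining pair
# `(T, S)` (`Ū ∘ T = S ∘ Ū`, `dU ∘ T⁻¹ = dU`); instance: COARSE GAUGE EQUIVARIANCE of `T4AveragingDisintegration.avgKernel`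

Track A of `YM-PLAN.md` (cell `pub-ymgap`, HUMAN RULING D-0062 ∕ D-0149 width seats), node **N21**; WIDTH SEAT `pub-ymgap-dag-n21-w2`
(gen 2), file 10 (seat numbering continues g0's files 1–9).  THEOREMS ONLY: 0 `def`, 0 `sorry`; COUNT-NEUTRAL; `--kind proof --supports stmt-QuantumFields-20544 --as helper`.
Imports `Literature/…/T4AveragingDisintegration` (`jointLaw`, `condLaw`, `avgKernel`, `fst_compProd_condLaw`, `margDensity`,
`kernelTransport`), `Literature/…/B12RTGaugeInvariance254` (`liftTransf`, `invTransf`, `avg_gaugeAct_liftTransf`, `measurable_gaugeAct`,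
`measurePreserving_gaugeAct`, `LiftInvariant`) and `Literature/…/T4ShellMeasureDet` (`slotAntiConcentration_map_iff`).  NO Theses import.  Restates nothing; cites by name.

WHY.  dag-n21-d g9's HANDOFF §2 (a) (the lane owner of N21's shell split of record): the top slot of a (2.18) term of record is
`rstepSlot ∘ tstepOfRecord = margDensity(V) · ∫ … condLaw(V, dU)` (`T4AveragingDisintegration.kernelTransport`), and a «mixture linearity»
reduction of the per-fibre (M1) to ONE-STEP kernels «needs an EQUIVARIANCE lemma for `condLaw` along Haar block averaging (fibre laws are
translates) — NOT in the tree».  The tree has the DENSITY-level sentence of [Balaban1987RG1] p. 254∕265 («if ρ is gauge invariant then Tρ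
is gauge invariant»: `B12RTGaugeInvariance254.rtOpI_gaugeInvariant_ae`) and the IMAGE-LAW-level one (`AveragingImageLawGaugeInvariance.
map_gaugeAct_imageLaw`: `Ū_*(dU)` is coarse-gauge invariant); this file supplies the KERNEL-level statement in between: the conditional
law of the fine field GIVEN the coarse one is carried to itself by the pair (fine transformation, coarse transformation).

WHAT IS PROVED ([folklore] measure theory: UNIQUENESS of the disintegration of a finite measure on `α × β`, `β` standard Borel —
Mathlib `ProbabilityTheory.eq_condKernel_of_measure_eq_compProd` — applied to the transported kernel `V ↦ (condLaw (S⁻¹ V)).map T`).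
* §1 GENERIC (`ν` finite on a standard Borel `β`, `avg : β → α` measurable, `T : β → β` measurable, `S : α ≃ᵐ α`,
  `hST : ∀ U, avg (T U) = S (avg U)`, `hν : ν.map T = ν`):
  `jointLaw_map_prodMap` (the joint law of `(Ū, U)` is `S × T`-invariant) · `map_avg_map_eq` (so is the image law `ν.map Ū` under `S`) ·
  `compProd_transport_eq_jointLaw` (the transported kernel disintegrates the joint law over the same marginal) ·
  ★ `condLaw_map_ae_eq` : `∀ᵐ V ∂(ν.map Ū), (condLaw ν Ū V).map T = condLaw ν Ū (S V)` ·
  set form `condLaw_apply_ae_eq_preimage` (`condLaw (S V) A = condLaw V (T ⁻¹' A)`), integrand forms `lintegral_condLaw_ae_eq` ∕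
  `integral_condLaw_ae_eq` (`∫ f d(condLaw (S V)) = ∫ f ∘ T d(condLaw V)`).
* §2 GAUGE FIELDS: for EVERY averaging `av : Averaging P j G` of the standing range `j + 1 ≤ m + K` with measurable `av.avg`, every
  standard Borel gauge group with Haar data and every COARSE gauge transformation `v`, with `T := U ↦ U^{v∘blockOf}`
  (`GaugeField.gaugeAct (liftTransf v)`) and `S := V ↦ V^v`:
  ★★ `avgKernel_map_gaugeAct_ae_eq` : `∀ᵐ V ∂(dU.map Ū), (avgKernel av.avg V).map (·^{v∘blockOf}) = avgKernel av.avg (V^v)` —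
  THE FIBRE LAWS ALONG A COARSE GAUGE ORBIT ARE GAUGE TRANSPORTS OF ONE ANOTHER — with its set form
  `avgKernel_gaugeAct_apply_ae_eq_preimage` and integrand forms `lintegral_avgKernel_gaugeAct_ae_eq` ∕ `integral_avgKernel_gaugeAct_ae_eq`.
* §3 GENERIC, densities (additionally `Ū_*ν ≪ μ` and `μ.map S = μ`): `margDensity_comp_ae_eq` (the marginal density `d(Ū_*ν)/dμ` is `S`-invariant
  `μ`-a.e.; Mathlib `MeasurableEmbedding.rnDeriv_map`) · ★ `kernelTransport_apply_ae_eq` : for EVERY measurable density `ρ`,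
  `∀ᵐ V ∂μ, kernelTransport ν μ Ū ρ (S V) = kernelTransport ν μ Ū (ρ ∘ T) V` (where the marginal density vanishes both sides vanish; elsewhere §1).
* §4 GAUGE FIELDS, densities (`HaarAC Ū`): `avgDensity_gaugeAct_ae_eq` · ★★ `transportK_gaugeAct_ae_eq` : `∀ᵐ V ∂dV, (Tρ)(V^v) = (T(U ↦ ρ(U^{v∘blockOf})))(V)`
  for EVERY measurable density — the kernel-transport companion, valid beyond invariant densities, of [Balaban1987RG1] p. 254's sentence
  (`B12RTGaugeInvariance254.rtOpI_gaugeInvariant_ae`) · corollary `transportK_gaugeAct_ae_eq_of_liftInvariant` (`LiftInvariant ρ ⇒ (Tρ)(V^v) = (Tρ)(V)` a.e.).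
* §5 CONSEQUENCE FOR (M1) (`T4ShellMeasure.SlotAntiConcentration`, N21's per-fibre binder shape; `T4ShellMeasureDet.slotAntiConcentration_map_iff`):
  `slotAntiConcentration_condLaw_ae_iff` ((M1) over `S V` for `u` ⟺ (M1) over `V` for `u ∘ T`, a.e., same constants) · ★
  `slotAntiConcentration_avgKernel_gaugeAct_ae_iff` (for a LIFT-INVARIANT measurable statistic, (M1) along the averaging fibres is a
  GAUGE-INVARIANT condition on the coarse field, a.e. — read it on one representative per coarse gauge orbit).

HONEST FRAMING.  [folklore] bookkeeping over Mathlib's `Measure.condKernel` and the tree's landed covariance ∕ invariance lemmas;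
TRANSITIVITY («all fibre laws are transports of ONE reference fibre law») is NOT claimed — the coarse gauge group is not transitive on coarse
fields (only bond by bond, cf. `AveragingImageLawGaugeInvariance.map_mul_left_bondLaw`); any other intertwining pair a consumer exhibits
(translations for a translation-covariant averaging) is served by §1 verbatim.  Nothing of Bałaban's is asserted; (M1) ∕ NE7c NOT PRINTED ∕
NOT proved; **N21 NOT discharged**; K3⁷ NOT claimed; counts UNMOVED (typed 28∕28 · discharged 5∕27); one finite four-torus programme at
fixed `ε` — NOT ℝ⁴, NOT infinite volume, NOT OS, NOT a mass gap, NOT Clay.  No decl below carries a cite tag.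
-/

noncomputable section

open MeasureTheory ProbabilityTheory
open scoped ENNReal

namespace Summit.QuantumFields.YangMills.Theorems.N21AvgKernelEquivariance

open Literature.MathematicalPhysics.QuantumFieldTheory.Balaban1983to89
open T4AveragingDisintegration (jointLaw condLaw measurable_graphMap jointLaw_fst fst_compProd_condLaw avgKernel)
open B12RTGaugeInvariance254 (invTransf liftTransf gaugeAct_inv_gaugeAct gaugeAct_gaugeAct_inv avg_gaugeAct_liftTransf
  measurable_gaugeAct measurePreserving_gaugeAct)

/-! ## §1 Generic: the conditional kernel along a measure-preserving intertwining pair -/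

section Generic

variable {α β : Type*} [MeasurableSpace α] [MeasurableSpace β]

/-- **The joint law of `(Ū, U)` is invariant under `S × T`** whenever `Ū ∘ T = S ∘ Ū` and `T` preserves `ν`. [folklore] -/
theorem jointLaw_map_prodMap (ν : Measure β) {avg : β → α} (havg : Measurable avg) {T : β → β} (hT : Measurable T)
    {S : α → α} (hS : Measurable S) (hST : ∀ U, avg (T U) = S (avg U)) (hν : ν.map T = ν) :
    (jointLaw ν avg).map (Prod.map S T) = jointLaw ν avg := by
  unfold jointLaw
  rw [Measure.map_map (hS.prodMap hT) (measurable_graphMap havg)]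
  have h : (Prod.map S T ∘ fun U => (avg U, U)) = (fun U => (avg U, U)) ∘ T := by
    funext U
    simp only [Function.comp_apply, Prod.map_apply, hST U]
  rw [h, ← Measure.map_map (measurable_graphMap havg) hT, hν]

/-- The image law `ν.map Ū` is `S`-invariant. [folklore] -/
theorem map_avg_map_eq (ν : Measure β) {avg : β → α} (havg : Measurable avg) {T : β → β} (hT : Measurable T)
    {S : α → α} (hS : Measurable S) (hST : ∀ U, avg (T U) = S (avg U)) (hν : ν.map T = ν) :
    (ν.map avg).map S = ν.map avg := by
  rw [Measure.map_map hS havg]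
  have h : S ∘ avg = avg ∘ T := funext fun U => (hST U).symm
  rw [h, ← Measure.map_map havg hT, hν]

variable [StandardBorelSpace β] [Nonempty β]

/-- **The transported kernel `V ↦ (condLaw (S⁻¹ V)).map T` disintegrates the joint law** over its first marginal (change of variables
`V = S W` in the marginal, `S × T`-invariance of the joint law). [folklore] -/
theorem compProd_transport_eq_jointLaw (ν : Measure β) [IsFiniteMeasure ν] {avg : β → α} (havg : Measurable avg)
    {T : β → β} (hT : Measurable T) (S : α ≃ᵐ α) (hST : ∀ U, avg (T U) = S (avg U)) (hν : ν.map T = ν) :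
    (jointLaw ν avg).fst ⊗ₘ ((condLaw ν avg).comap S.symm S.symm.measurable).map T = jointLaw ν avg := by
  have hfst : (jointLaw ν avg).fst = ν.map avg := jointLaw_fst ν havg
  have hμS : (ν.map avg).map S = ν.map avg := map_avg_map_eq ν havg hT S.measurable hST hν
  have hJ : (jointLaw ν avg).map (Prod.map S T) = jointLaw ν avg := jointLaw_map_prodMap ν havg hT S.measurable hST hν
  ext s hs
  have hint : ∀ a, (((condLaw ν avg).comap S.symm S.symm.measurable).map T) a (Prod.mk a ⁻¹' s)
      = condLaw ν avg (S.symm a) (T ⁻¹' (Prod.mk a ⁻¹' s)) := fun a => by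
    rw [Kernel.map_apply' _ hT _ (measurable_prodMk_left hs), Kernel.comap_apply]
  calc ((jointLaw ν avg).fst ⊗ₘ ((condLaw ν avg).comap S.symm S.symm.measurable).map T) s
      = ∫⁻ a, (((condLaw ν avg).comap S.symm S.symm.measurable).map T) a (Prod.mk a ⁻¹' s) ∂(jointLaw ν avg).fst :=
        Measure.compProd_apply hs
    _ = ∫⁻ a, condLaw ν avg (S.symm a) (T ⁻¹' (Prod.mk a ⁻¹' s)) ∂((ν.map avg).map S) := by
        rw [hfst, hμS]; exact lintegral_congr hint
    _ = ∫⁻ b, condLaw ν avg (S.symm (S b)) (T ⁻¹' (Prod.mk (S b) ⁻¹' s)) ∂(ν.map avg) := lintegral_map_equiv _ S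
    _ = ∫⁻ b, condLaw ν avg b (Prod.mk b ⁻¹' (Prod.map S T ⁻¹' s)) ∂(jointLaw ν avg).fst := by
        rw [hfst]; exact lintegral_congr fun b => by rw [S.symm_apply_apply]; rfl
    _ = ((jointLaw ν avg).fst ⊗ₘ condLaw ν avg) (Prod.map S T ⁻¹' s) :=
        (Measure.compProd_apply (hs.preimage (S.measurable.prodMap hT))).symm
    _ = (jointLaw ν avg).map (Prod.map S T) s := by
        rw [fst_compProd_condLaw, Measure.map_apply (S.measurable.prodMap hT) hs]
    _ = jointLaw ν avg s := by rw [hJ]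

/-- ★ **EQUIVARIANCE OF THE CONDITIONAL LAW.**  For a finite measure `ν` on a standard Borel space, a measurable `Ū : β → α`, a
measurable `T : β → β` and a measurable equivalence `S` of `α` with `Ū ∘ T = S ∘ Ū` and `ν.map T = ν`: for `(ν.map Ū)`-almost every
coarse point `V`, the fibre law over `S V` is the `T`-transport of the fibre law over `V` — `(condLaw ν Ū V).map T = condLaw ν Ū (S V)`
(uniqueness of disintegration, `ProbabilityTheory.eq_condKernel_of_measure_eq_compProd`, for the transported kernel). [folklore] -/
theorem condLaw_map_ae_eq (ν : Measure β) [IsFiniteMeasure ν] {avg : β → α} (havg : Measurable avg)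
    {T : β → β} (hT : Measurable T) (S : α ≃ᵐ α) (hST : ∀ U, avg (T U) = S (avg U)) (hν : ν.map T = ν) :
    ∀ᵐ V ∂(ν.map avg), (condLaw ν avg V).map T = condLaw ν avg (S V) := by
  have hκ : jointLaw ν avg = (jointLaw ν avg).fst ⊗ₘ ((condLaw ν avg).comap S.symm S.symm.measurable).map T :=
    (compProd_transport_eq_jointLaw ν havg hT S hST hν).symm
  have hu := eq_condKernel_of_measure_eq_compProd (((condLaw ν avg).comap S.symm S.symm.measurable).map T) hκ
  rw [jointLaw_fst ν havg] at hu
  have hu' : ∀ᵐ a ∂(ν.map avg), (condLaw ν avg (S.symm a)).map T = condLaw ν avg a := by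
    filter_upwards [hu] with a ha
    rw [Kernel.map_apply _ hT, Kernel.comap_apply] at ha
    exact ha
  rw [← map_avg_map_eq ν havg hT S.measurable hST hν] at hu'
  filter_upwards [ae_of_ae_map S.measurable.aemeasurable hu'] with V hV
  rwa [S.symm_apply_apply] at hV

/-- Set form: `condLaw (S V) A = condLaw V (T ⁻¹' A)` for `(ν.map Ū)`-a.e. `V`, every measurable `A`. [folklore] -/
theorem condLaw_apply_ae_eq_preimage (ν : Measure β) [IsFiniteMeasure ν] {avg : β → α} (havg : Measurable avg)
    {T : β → β} (hT : Measurable T) (S : α ≃ᵐ α) (hST : ∀ U, avg (T U) = S (avg U)) (hν : ν.map T = ν)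
    {A : Set β} (hA : MeasurableSet A) :
    ∀ᵐ V ∂(ν.map avg), condLaw ν avg (S V) A = condLaw ν avg V (T ⁻¹' A) := by
  filter_upwards [condLaw_map_ae_eq ν havg hT S hST hν] with V hV
  rw [← hV, Measure.map_apply hT hA]

/-- Integrand form (`ℝ≥0∞`): `∫⁻ f d(condLaw (S V)) = ∫⁻ f ∘ T d(condLaw V)` for `(ν.map Ū)`-a.e. `V`, every measurable `f`. [folklore] -/
theorem lintegral_condLaw_ae_eq (ν : Measure β) [IsFiniteMeasure ν] {avg : β → α} (havg : Measurable avg)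
    {T : β → β} (hT : Measurable T) (S : α ≃ᵐ α) (hST : ∀ U, avg (T U) = S (avg U)) (hν : ν.map T = ν)
    {f : β → ℝ≥0∞} (hf : Measurable f) :
    ∀ᵐ V ∂(ν.map avg), ∫⁻ U, f U ∂(condLaw ν avg (S V)) = ∫⁻ U, f (T U) ∂(condLaw ν avg V) := by
  filter_upwards [condLaw_map_ae_eq ν havg hT S hST hν] with V hV
  rw [← hV, lintegral_map hf hT]

/-- Integrand form (Bochner): `∫ g d(condLaw (S V)) = ∫ g ∘ T d(condLaw V)` for `(ν.map Ū)`-a.e. `V`, every strongly measurable `g`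
(the shape in which `T4AveragingDisintegration.kernelTransport` reads the kernel). [folklore] -/
theorem integral_condLaw_ae_eq {E : Type*} [NormedAddCommGroup E] [NormedSpace ℝ E]
    (ν : Measure β) [IsFiniteMeasure ν] {avg : β → α} (havg : Measurable avg)
    {T : β → β} (hT : Measurable T) (S : α ≃ᵐ α) (hST : ∀ U, avg (T U) = S (avg U)) (hν : ν.map T = ν)
    {g : β → E} (hg : StronglyMeasurable g) :
    ∀ᵐ V ∂(ν.map avg), ∫ U, g U ∂(condLaw ν avg (S V)) = ∫ U, g (T U) ∂(condLaw ν avg V) := by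
  filter_upwards [condLaw_map_ae_eq ν havg hT S hST hν] with V hV
  rw [← hV, integral_map hT.aemeasurable hg.aestronglyMeasurable]

end Generic

/-! ## §2 Gauge fields: COARSE GAUGE EQUIVARIANCE of the averaging kernel of every covariant averaging -/

section Gauge

variable {P : Params} {j : ℕ} {G : Type*} [GaugeGroup G] [MeasurableSpace G] [HaarData G] [MeasurableMul₂ G]
  [StandardBorelSpace G]

/-- ★★ **THE AVERAGING KERNEL IS GAUGE-EQUIVARIANT.**  For every averaging `av` of the standing range `j + 1 ≤ m + K` with measurable
`Ū = av.avg`, and every COARSE gauge transformation `v` of `T^{(j+1)}`: for `(dU.map Ū)`-almost every coarse field `V`, the law of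
`U^{v∘blockOf}` under the fibre law `avgKernel Ū V` IS the fibre law over `V^v` — `(avgKernel Ū V).map (·^{v∘blockOf}) = avgKernel Ū (V^v)`.
Inputs: the printed covariance `Ū(U^{v∘blockOf}) = (ŪU)^v` (`avg_gaugeAct_liftTransf`) and the gauge invariance of `dU`
(`measurePreserving_gaugeAct`); the coarse action `V ↦ V^v` is a measurable equivalence with inverse `V ↦ V^{v⁻¹}`. [folklore] -/
theorem avgKernel_map_gaugeAct_ae_eq (hj : j + 1 ≤ P.m + P.K) (av : Averaging P j G) (havg : Measurable av.avg)
    (v : GaugeTransf P (j + 1) G) :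
    ∀ᵐ V ∂((fieldMeasure P j G).map av.avg),
      (avgKernel av.avg V).map (GaugeField.gaugeAct (liftTransf v)) = avgKernel av.avg (GaugeField.gaugeAct v V) := by
  let S : GaugeField P (j + 1) G ≃ᵐ GaugeField P (j + 1) G :=
    { toFun := GaugeField.gaugeAct v
      invFun := GaugeField.gaugeAct (invTransf v)
      left_inv := gaugeAct_inv_gaugeAct v
      right_inv := gaugeAct_gaugeAct_inv v
      measurable_toFun := measurable_gaugeAct v
      measurable_invFun := measurable_gaugeAct (invTransf v) }
  exact condLaw_map_ae_eq (fieldMeasure P j G) havg (measurable_gaugeAct (liftTransf v)) S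
    (fun U => avg_gaugeAct_liftTransf hj av v U) (measurePreserving_gaugeAct (liftTransf v)).map_eq

/-- Set form: `avgKernel Ū (V^v) A = avgKernel Ū V ((·^{v∘blockOf}) ⁻¹' A)` for `(dU.map Ū)`-a.e. `V`, every measurable `A`. [folklore] -/
theorem avgKernel_gaugeAct_apply_ae_eq_preimage (hj : j + 1 ≤ P.m + P.K) (av : Averaging P j G) (havg : Measurable av.avg)
    (v : GaugeTransf P (j + 1) G) {A : Set (GaugeField P j G)} (hA : MeasurableSet A) :
    ∀ᵐ V ∂((fieldMeasure P j G).map av.avg),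
      avgKernel av.avg (GaugeField.gaugeAct v V) A = avgKernel av.avg V (GaugeField.gaugeAct (liftTransf v) ⁻¹' A) := by
  filter_upwards [avgKernel_map_gaugeAct_ae_eq hj av havg v] with V hV
  rw [← hV, Measure.map_apply (measurable_gaugeAct (liftTransf v)) hA]

/-- Integrand form (`ℝ≥0∞`): `∫⁻ f d(avgKernel Ū (V^v)) = ∫⁻ U, f (U^{v∘blockOf}) d(avgKernel Ū V)` for `(dU.map Ū)`-a.e. `V`. [folklore] -/
theorem lintegral_avgKernel_gaugeAct_ae_eq (hj : j + 1 ≤ P.m + P.K) (av : Averaging P j G) (havg : Measurable av.avg)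
    (v : GaugeTransf P (j + 1) G) {f : GaugeField P j G → ℝ≥0∞} (hf : Measurable f) :
    ∀ᵐ V ∂((fieldMeasure P j G).map av.avg),
      ∫⁻ U, f U ∂(avgKernel av.avg (GaugeField.gaugeAct v V))
        = ∫⁻ U, f (GaugeField.gaugeAct (liftTransf v) U) ∂(avgKernel av.avg V) := by
  filter_upwards [avgKernel_map_gaugeAct_ae_eq hj av havg v] with V hV
  rw [← hV, lintegral_map hf (measurable_gaugeAct (liftTransf v))]

/-- Integrand form (Bochner): `∫ g d(avgKernel Ū (V^v)) = ∫ U, g (U^{v∘blockOf}) d(avgKernel Ū V)` for `(dU.map Ū)`-a.e. `V` — the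
kernel-level companion of [Balaban1987RG1] p. 254's density-level sentence (`B12RTGaugeInvariance254.rtOpI_gaugeInvariant_ae`). [folklore] -/
theorem integral_avgKernel_gaugeAct_ae_eq {E : Type*} [NormedAddCommGroup E] [NormedSpace ℝ E]
    (hj : j + 1 ≤ P.m + P.K) (av : Averaging P j G) (havg : Measurable av.avg)
    (v : GaugeTransf P (j + 1) G) {g : GaugeField P j G → E} (hg : StronglyMeasurable g) :
    ∀ᵐ V ∂((fieldMeasure P j G).map av.avg),
      ∫ U, g U ∂(avgKernel av.avg (GaugeField.gaugeAct v V))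
        = ∫ U, g (GaugeField.gaugeAct (liftTransf v) U) ∂(avgKernel av.avg V) := by
  filter_upwards [avgKernel_map_gaugeAct_ae_eq hj av havg v] with V hV
  rw [← hV, integral_map (measurable_gaugeAct (liftTransf v)).aemeasurable hg.aestronglyMeasurable]

end Gauge

/-! ## §3 Generic: the marginal density and the KERNEL TRANSPORT of densities along the pair `(T, S)` -/

section Transport

variable {α β : Type*} [MeasurableSpace α] [MeasurableSpace β] [StandardBorelSpace β] [Nonempty β]

open T4AveragingDisintegration (margDensity measurable_margDensity withDensity_margDensity kernelTransport)

omit [StandardBorelSpace β] [Nonempty β] in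
/-- **The marginal density `d(Ū_*ν)/dμ` is `S`-invariant `μ`-a.e.** when, in addition, the coarse reference measure `μ` is `S`-invariant
(Mathlib `MeasurableEmbedding.rnDeriv_map` at the equivalence `S`, both measures `S`-invariant). [folklore] -/
theorem margDensity_comp_ae_eq (ν : Measure β) [IsFiniteMeasure ν] (μ : Measure α) [SigmaFinite μ] {avg : β → α}
    (havg : Measurable avg) {T : β → β} (hT : Measurable T) (S : α ≃ᵐ α) (hST : ∀ U, avg (T U) = S (avg U))
    (hν : ν.map T = ν) (hμS : μ.map S = μ) :
    ∀ᵐ V ∂μ, margDensity ν μ avg (S V) = margDensity ν μ avg V := by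
  have h := S.measurableEmbedding.rnDeriv_map (ν.map avg) μ
  rw [hμS, map_avg_map_eq ν havg hT S.measurable hST hν] at h
  filter_upwards [h] with V hV
  unfold margDensity T4TermReprCoupling.rnNN
  rw [jointLaw_fst ν havg, hV]

/-- ★ **THE KERNEL TRANSPORT COMMUTES WITH THE PAIR**: for `μ`-almost every coarse point `V` and EVERY measurable density `ρ` of the fine
variable, `(Tρ)(S V) = (T(ρ ∘ T))(V)` — `kernelTransport ν μ Ū ρ (S V) = kernelTransport ν μ Ū (ρ ∘ T) V` (`Ū_*ν ≪ μ`, `μ` `S`-invariant; where the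
marginal density vanishes both sides vanish, elsewhere §1's kernel identity applies). [folklore] -/
theorem kernelTransport_apply_ae_eq (ν : Measure β) [IsFiniteMeasure ν] (μ : Measure α) [SigmaFinite μ] {avg : β → α}
    (havg : Measurable avg) (hac : ν.map avg ≪ μ) {T : β → β} (hT : Measurable T) (S : α ≃ᵐ α)
    (hST : ∀ U, avg (T U) = S (avg U)) (hν : ν.map T = ν) (hμS : μ.map S = μ) {ρ : β → ℝ} (hρ : Measurable ρ) :
    ∀ᵐ V ∂μ, kernelTransport ν μ avg ρ (S V) = kernelTransport ν μ avg (ρ ∘ T) V := by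
  have h1 := margDensity_comp_ae_eq ν μ havg hT S hST hν hμS
  have h2 : ∀ᵐ V ∂(ν.map avg), ∫ U, ρ U ∂(condLaw ν avg (S V)) = ∫ U, ρ (T U) ∂(condLaw ν avg V) :=
    integral_condLaw_ae_eq ν havg hT S hST hν hρ.stronglyMeasurable
  rw [← withDensity_margDensity ν μ havg hac, ae_withDensity_iff measurable_margDensity.coe_nnreal_ennreal] at h2
  filter_upwards [h1, h2] with V hV1 hV2
  unfold kernelTransport
  rw [hV1]
  by_cases h0 : margDensity ν μ avg V = 0
  · simp [h0]
  · rw [hV2 (ENNReal.coe_ne_zero.mpr h0)]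
    rfl

end Transport

/-! ## §4 Gauge fields: the one-step kernel transport `transportK` commutes with coarse gauge transformations, EVERY density -/

section GaugeTransport

open T4FiniteEpsInhabited (HaarAC)
open T4AveragingDisintegration (transportK avgDensity)

variable {P : Params} {j : ℕ} {G : Type*} [GaugeGroup G] [MeasurableSpace G] [HaarData G] [MeasurableMul₂ G]
  [StandardBorelSpace G]

omit [StandardBorelSpace G] in
/-- The one-step marginal density `avgDensity Ū = d(Ū_*dU)/dV` is coarse-gauge invariant `dV`-a.e. (`dV` and `Ū_*dU` both gauge invariant). [folklore] -/
theorem avgDensity_gaugeAct_ae_eq (hj : j + 1 ≤ P.m + P.K) (av : Averaging P j G) (havg : Measurable av.avg)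
    (v : GaugeTransf P (j + 1) G) :
    ∀ᵐ V ∂(fieldMeasure P (j + 1) G), avgDensity av.avg (GaugeField.gaugeAct v V) = avgDensity av.avg V := by
  let S : GaugeField P (j + 1) G ≃ᵐ GaugeField P (j + 1) G :=
    { toFun := GaugeField.gaugeAct v
      invFun := GaugeField.gaugeAct (invTransf v)
      left_inv := gaugeAct_inv_gaugeAct v
      right_inv := gaugeAct_gaugeAct_inv v
      measurable_toFun := measurable_gaugeAct v
      measurable_invFun := measurable_gaugeAct (invTransf v) }
  exact margDensity_comp_ae_eq (fieldMeasure P j G) (fieldMeasure P (j + 1) G) havg (measurable_gaugeAct (liftTransf v)) S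
    (fun U => avg_gaugeAct_liftTransf hj av v U) (measurePreserving_gaugeAct (liftTransf v)).map_eq
    (measurePreserving_gaugeAct v).map_eq

/-- ★★ **THE ONE-STEP KERNEL TRANSPORT COMMUTES WITH COARSE GAUGE TRANSFORMATIONS, FOR EVERY MEASURABLE DENSITY**: under `HaarAC Ū`,
for `dV`-almost every coarse field `V`, `(Tρ)(V^v) = (T(U ↦ ρ(U^{v∘blockOf})))(V)` — the kernel-transport companion, valid for ALL densities,
of [Balaban1987RG1] p. 254's «if ρ is gauge invariant then Tρ is gauge invariant» (`B12RTGaugeInvariance254.rtOpI_gaugeInvariant_ae`). [folklore] -/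
theorem transportK_gaugeAct_ae_eq (hj : j + 1 ≤ P.m + P.K) (av : Averaging P j G) (havg : Measurable av.avg)
    (hac : HaarAC av.avg) (v : GaugeTransf P (j + 1) G) {ρ : Density P j G} (hρ : Measurable ρ) :
    ∀ᵐ V ∂(fieldMeasure P (j + 1) G),
      transportK av.avg ρ (GaugeField.gaugeAct v V) = transportK av.avg (ρ ∘ GaugeField.gaugeAct (liftTransf v)) V := by
  let S : GaugeField P (j + 1) G ≃ᵐ GaugeField P (j + 1) G :=
    { toFun := GaugeField.gaugeAct v
      invFun := GaugeField.gaugeAct (invTransf v)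
      left_inv := gaugeAct_inv_gaugeAct v
      right_inv := gaugeAct_gaugeAct_inv v
      measurable_toFun := measurable_gaugeAct v
      measurable_invFun := measurable_gaugeAct (invTransf v) }
  exact kernelTransport_apply_ae_eq (fieldMeasure P j G) (fieldMeasure P (j + 1) G) havg hac
    (measurable_gaugeAct (liftTransf v)) S (fun U => avg_gaugeAct_liftTransf hj av v U)
    (measurePreserving_gaugeAct (liftTransf v)).map_eq (measurePreserving_gaugeAct v).map_eq hρ

/-- COROLLARY (the p. 254 sentence itself, for `transportK`, as an a.e. identity): if `ρ` is invariant under the block-constant lifts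
(`B12RTGaugeInvariance254.LiftInvariant ρ`), then `(Tρ)(V^v) = (Tρ)(V)` for `dV`-a.e. `V`. [folklore] -/
theorem transportK_gaugeAct_ae_eq_of_liftInvariant (hj : j + 1 ≤ P.m + P.K) (av : Averaging P j G) (havg : Measurable av.avg)
    (hac : HaarAC av.avg) (v : GaugeTransf P (j + 1) G) {ρ : Density P j G} (hρ : Measurable ρ)
    (hinv : B12RTGaugeInvariance254.LiftInvariant ρ) :
    ∀ᵐ V ∂(fieldMeasure P (j + 1) G), transportK av.avg ρ (GaugeField.gaugeAct v V) = transportK av.avg ρ V := by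
  have hρ' : (ρ ∘ GaugeField.gaugeAct (liftTransf v)) = ρ := funext fun U => hinv v U
  filter_upwards [transportK_gaugeAct_ae_eq hj av havg hac v hρ] with V hV
  rw [hV, hρ']

end GaugeTransport

/-! ## §5 Consequence for (M1): anti-concentration ALONG THE FIBRE LAWS is transported by the pair — a gauge-invariant condition -/

section M1

open T4ShellMeasure (SlotAntiConcentration)
open T4ShellMeasureDet (slotAntiConcentration_map_iff)

variable {α β : Type*} [MeasurableSpace α] [MeasurableSpace β] [StandardBorelSpace β] [Nonempty β]

/-- (M1) (`T4ShellMeasure.SlotAntiConcentration`) for the fibre law over `S V` and a measurable statistic `u` ⟺ (M1) for the fibre law over `V`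
and the statistic `u ∘ T`, SAME constants, for `(ν.map Ū)`-a.e. `V` (§1 + `T4ShellMeasureDet.slotAntiConcentration_map_iff`). [folklore] -/
theorem slotAntiConcentration_condLaw_ae_iff (ν : Measure β) [IsFiniteMeasure ν] {avg : β → α} (havg : Measurable avg)
    {T : β → β} (hT : Measurable T) (S : α ≃ᵐ α) (hST : ∀ U, avg (T U) = S (avg U)) (hν : ν.map T = ν)
    {u : β → ℝ} (hu : Measurable u) (θ ρ D : ℝ) :
    ∀ᵐ V ∂(ν.map avg),
      SlotAntiConcentration (condLaw ν avg (S V)) u θ ρ D ↔ SlotAntiConcentration (condLaw ν avg V) (u ∘ T) θ ρ D := by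
  filter_upwards [condLaw_map_ae_eq ν havg hT S hST hν] with V hV
  rw [← hV]
  exact slotAntiConcentration_map_iff hT hu

variable {P : Params} {j : ℕ} {G : Type*} [GaugeGroup G] [MeasurableSpace G] [HaarData G] [MeasurableMul₂ G]
  [StandardBorelSpace G]

omit [StandardBorelSpace β] [Nonempty β] in
/-- ★ **(M1) ALONG THE AVERAGING FIBRES IS A GAUGE-INVARIANT CONDITION ON THE COARSE FIELD** for a lift-invariant measurable statistic
(`u (U^{v∘blockOf}) = u U` — every gauge-invariant statistic): for `(dU.map Ū)`-a.e. `V`, (M1) for `avgKernel Ū (V^v)` ⟺ (M1) for `avgKernel Ū V`,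
SAME `θ ρ D` — so a per-fibre (M1) binder along `Ū` need only be read on one representative per coarse gauge orbit (a.e.). [folklore] -/
theorem slotAntiConcentration_avgKernel_gaugeAct_ae_iff (hj : j + 1 ≤ P.m + P.K) (av : Averaging P j G) (havg : Measurable av.avg)
    (v : GaugeTransf P (j + 1) G) {u : GaugeField P j G → ℝ} (hu : Measurable u)
    (hinv : ∀ U, u (GaugeField.gaugeAct (liftTransf v) U) = u U) (θ ρ D : ℝ) :
    ∀ᵐ V ∂((fieldMeasure P j G).map av.avg),
      SlotAntiConcentration (avgKernel av.avg (GaugeField.gaugeAct v V)) u θ ρ D ↔ SlotAntiConcentration (avgKernel av.avg V) u θ ρ D := by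
  have hcomp : u ∘ GaugeField.gaugeAct (liftTransf v) = u := funext hinv
  filter_upwards [avgKernel_map_gaugeAct_ae_eq hj av havg v] with V hV
  rw [← hV, slotAntiConcentration_map_iff (measurable_gaugeAct (liftTransf v)) hu, hcomp]

end M1

end Summit.QuantumFields.YangMills.Theorems.N21AvgKernelEquivariance

end
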